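import Literature.AlgebraicGeometry.Resolution.SemiStableFibresIntegral
import Literature.AlgebraicGeometry.Resolution.RelativeDimensionStrict
import Literature.AlgebraicGeometry.Dimension.PointDimension
import Mathlib.AlgebraicGeometry.Morphisms.Integral
import HarnessLib

/-!
# The base of a pointed semi-stable family has smaller dimension (de Jong 1996, 4.22)

Topic: `Literature/AlgebraicGeometry/Resolution`. The dimension count in de Jong 1996, 4.22 ("At
this point we apply the induction hypothesis" — to the base `(Y, D)` of the curve `𝒞 → Y`, a
variety of dimension `dim 𝒞 - 1`): for a pre-semi-stable pair `(𝒞 → Y, D, τ)`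
(`DeJong1996.PreSemiStablePair`) one has `dim Y < dim 𝒞`. PROVED here:

* **incomparability for integral morphisms of schemes** (`eq_of_specializes_of_isIntegralHom`):
  an integral morphism never identifies a point with a proper specialization of it — affine
  locally this is Mathlib's `Ideal.IsIntegral.comap_lt_comap`;
* the geometric generic fibre `𝒞 ×_Y Spec κ(η)^alg` of the family is an integral scheme
  (`SemiStableFibresIntegral.lean`) with at least two points (a one-point integral scheme has a
  field as local ring at its closed point, which is neither regular of dimension one nor an
  ordinary double point, against 2.21), and it is integral over the fibre `𝒞_η`; by
  incomparability `𝒞_η`, i.e. `f⁻¹(η)`, is not reduced to the generic point of `𝒞`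
  (`PreSemiStablePair.exists_ne_genericPoint`);
* hence `dim Y + 1 ≤ dim 𝒞` (`RelativeDimensionStrict.topologicalKrullDim_base_add_one_le`) and,
  `𝒞` being of finite type over `k`, `dim Y < dim 𝒞` (`PreSemiStablePair.topologicalKrullDim_lt`);
* (the assembly `DeJong1996PreSemiStablePairToSemiStablePair.of_liu` — the named fact from Liu
  2002, Prop. 4.3.8 alone — lives in `SemiStableFibreDimension.lean`, which obtains the dimension
  count independently through closed fibres over an algebraically closed field; the generic-fibre
  route here needs no hypothesis on `k`).

## Sources

* A. J. de Jong, *Smoothness, semi-stability and alterations*, Publ. Math. IHÉS 83 (1996), 2.21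
  (p. 61), 4.22 (pp. 74–75).
* The Stacks Project, Tag 00GT (Lemma 10.36.20, incomparability: "nontrivial inclusions of
  primes of `S` lying over the same prime are impossible for `R → S` integral").
-/

noncomputable section

open CategoryTheory CategoryTheory.Limits AlgebraicGeometry TopologicalSpace Topology

namespace Literature.AlgebraicGeometry.Resolution

universe u

/-! ## Incomparability for integral morphisms -/

/-- **Incomparability** (Stacks 00GT, for schemes): if `p : X → Y` is an integral morphism,
`a ⤳ b` in `X` and `p a = p b`, then `a = b`. Affine-locally over `U ∋ p b` (the preimage
`p⁻¹(U)` is affine and contains `b`, hence its generization `a`), the primes `𝔭_a ≤ 𝔭_b` of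
`Γ(X, p⁻¹U)` contract to the same prime of `Γ(Y, U)`, so `𝔭_a = 𝔭_b` by
`Ideal.IsIntegral.comap_lt_comap`. [cite: StacksProject, Tag 00GT (Lemma 10.36.20)] -/
theorem eq_of_specializes_of_isIntegralHom {X Y : Scheme.{u}} (p : X ⟶ Y) [IsIntegralHom p]
    {a b : X} (hab : a ⤳ b) (hpab : p a = p b) : a = b := by
  obtain ⟨_, ⟨U, hU, rfl⟩, hbU, -⟩ :=
    Y.isBasis_affineOpens.exists_subset_of_mem_open (Set.mem_univ (p b)) isOpen_univ
  have hV : IsAffineOpen (p ⁻¹ᵁ U) := hU.preimage p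
  have hbV : b ∈ p ⁻¹ᵁ U := hbU
  have haV : a ∈ p ⁻¹ᵁ U := hab.mem_open (p ⁻¹ᵁ U).isOpen hbV
  -- the primes of `a` and `b` in `Γ(X, p⁻¹U)` and their common contraction
  have hle : hV.primeIdealOf ⟨a, haV⟩ ≤ hV.primeIdealOf ⟨b, hbV⟩ :=
    (Literature.AlgebraicGeometry.Dimension.Scheme.specializes_iff_primeIdealOf_le hV
      ⟨a, haV⟩ ⟨b, hbV⟩).mp hab
  have hca := IsAffineOpen.comap_primeIdealOf_appLE (f := p) U hU (p ⁻¹ᵁ U) hV le_rfl haV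
  have hcb := IsAffineOpen.comap_primeIdealOf_appLE (f := p) U hU (p ⁻¹ᵁ U) hV le_rfl hbV
  have hcomap : (hV.primeIdealOf ⟨a, haV⟩).comap (p.appLE U (p ⁻¹ᵁ U) le_rfl).hom =
      (hV.primeIdealOf ⟨b, hbV⟩).comap (p.appLE U (p ⁻¹ᵁ U) le_rfl).hom := by
    rw [hca, hcb]
    congr 2
  -- integrality of `Γ(Y, U) → Γ(X, p⁻¹U)`
  have hint : (p.appLE U (p ⁻¹ᵁ U) le_rfl).hom.IsIntegral := by
    rw [Scheme.Hom.appLE_eq_app]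
    exact p.isIntegral_app U hU
  algebraize [(p.appLE U (p ⁻¹ᵁ U) le_rfl).hom]
  -- `𝔭_a = 𝔭_b`, by incomparability
  have heq : hV.primeIdealOf ⟨a, haV⟩ = hV.primeIdealOf ⟨b, hbV⟩ := by
    by_contra hne
    have hlt : (hV.primeIdealOf ⟨a, haV⟩).asIdeal < (hV.primeIdealOf ⟨b, hbV⟩).asIdeal :=
      lt_of_le_of_ne hle fun h => hne (PrimeSpectrum.ext h)
    have := Ideal.IsIntegral.comap_lt_comap (R := Γ(Y, U)) hlt
    exact this.ne (congrArg PrimeSpectrum.asIdeal hcomap)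
  have := congrArg hV.fromSpec heq
  rwa [hV.fromSpec_primeIdealOf, hV.fromSpec_primeIdealOf] at this

/-- Dimension bookkeeping in `WithBot ℕ∞`: `a + 1 ≤ b` with `b` finite and not `⊥` gives
`a < b`. [folklore] -/
theorem WithBot.ENat.lt_of_add_one_le {a b : WithBot ℕ∞} (h : a + 1 ≤ b) (hb0 : b ≠ ⊥)
    (hb : b ≠ ⊤) : a < b := by
  induction b using WithBot.recBotCoe with
  | bot => exact absurd rfl hb0
  | coe b =>
    induction b using ENat.recTopCoe with
    | top => exact absurd rfl hb
    | coe b =>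
      induction a using WithBot.recBotCoe with
      | bot => exact WithBot.bot_lt_coe _
      | coe a =>
        induction a using ENat.recTopCoe with
        | top =>
          have : (⊤ : ℕ∞) + 1 ≤ b := by exact_mod_cast h
          exact absurd this (by simp)
        | coe a =>
          have : a + 1 ≤ b := by exact_mod_cast h
          exact_mod_cast Nat.lt_of_succ_le this

namespace DeJong1996

namespace PreSemiStablePair

variable {k : Type u} [Field k] {X Y : Scheme.{u}} {f : X ⟶ Y} {g : Y ⟶ Spec (.of k)}
  {D : Set Y} {n : ℕ} {τ : Fin n → (Y ⟶ X)}

/-! ## The generic fibre is not reduced to the generic point -/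

/-- The generic point of the base is off `D`. [folklore] -/
theorem genericPoint_notMem (h : PreSemiStablePair f g D τ) :
    haveI := h.isIntegral_base
    genericPoint Y ∉ D := by
  haveI := h.isIntegral_base
  intro hmem
  have hsub := ((genericPoint_spec Y).mem_closed_set_iff h.isClosed).mp hmem
  exact h.ne_univ (Set.eq_univ_of_univ_subset (by simpa using hsub))

/-- **A field-valued fibre of the family off `D` has at least two points**: it is an integral
scheme (`isIntegral_pullback`); if it were a single point, that point would be closed with local
ring a field, neither regular of dimension `1` nor an ordinary double point — but, over an
algebraically closed field, 2.21 requires one of the two at every closed point.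
[cite: DeJong1996, 2.21, p. 61] -/
theorem nontrivial_pullback (h : PreSemiStablePair f g D τ) (K : Type u) [Field K] [IsAlgClosed K]
    (s : Spec (.of K) ⟶ Y) (hs : ∀ t, s t ∉ D) : Nontrivial ↥(pullback f s) := by
  haveI := h.isIntegral_pullback K s hs
  by_contra hnt
  haveI : Subsingleton ↥(pullback f s) := not_nontrivial_iff_subsingleton.mp hnt
  have hpt : ({genericPoint (pullback f s : Scheme.{u})} : Set ↥(pullback f s)) = Set.univ :=
    Set.eq_univ_of_forall fun z => Subsingleton.elim z _
  have hx : IsClosed ({genericPoint (pullback f s : Scheme.{u})} : Set ↥(pullback f s)) := by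
    rw [hpt]
    exact isClosed_univ
  have hF : IsField ((pullback f s).presheaf.stalk (genericPoint (pullback f s : Scheme.{u}))) :=
    isField_stalk_of_closure_mem_irreducibleComponents (pullback f s) _
      (by simp [irreducibleComponents_eq_singleton, hpt])
  rcases h.isSemiStableCurve.isRegularLocalRing_or_isOrdinaryDoublePoint K s _ hx with
    ⟨-, hdim⟩ | hnode
  · rw [ringKrullDim_eq_zero_of_isField hF] at hdim
    exact zero_ne_one hdim
  · exact IsOrdinaryDoublePoint.not_of_isField K hF hnode

/-- **The generic fibre of the family is not reduced to the generic point of `𝒞`**: there is a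
point `b ≠ η_𝒞` of `𝒞` over the generic point `η` of `Y`. Otherwise the fibre `𝒞_η` is a
single point; the geometric generic fibre `𝒞 ×_Y Spec κ(η)^alg`, integral over `𝒞_η` (a base
change of `Spec κ(η)^alg → Spec κ(η)`), is an integral scheme with two points `ζ ⤳ x̄`
(`nontrivial_pullback`), which incomparability (`eq_of_specializes_of_isIntegralHom`) forbids.
[cite: DeJong1996, 4.22, p. 74] -/
theorem exists_ne_genericPoint (h : PreSemiStablePair f g D τ) :
    haveI := h.isIntegral
    haveI := h.isIntegral_base
    ∃ b : X, f b = genericPoint Y ∧ b ≠ genericPoint X := by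
  haveI := h.isIntegral
  haveI := h.isIntegral_base
  by_contra hno
  push Not at hno
  -- the fibre `𝒞_η` and its geometric version
  set η := genericPoint Y with hη
  let K : Type u := Y.residueField η
  let Kbar : Type u := AlgebraicClosure K
  let s : Spec (.of K) ⟶ Y := Y.fromSpecResidueField η
  let ι : Spec (.of Kbar) ⟶ Spec (.of K) := Spec.map (CommRingCat.ofHom (algebraMap K Kbar))
  have hs : ∀ t, s t = η := fun t => Scheme.fromSpecResidueField_apply η t
  have hsD : ∀ t, (ι ≫ s) t ∉ D := fun t => by
    rw [Scheme.Hom.comp_apply, hs]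
    exact h.genericPoint_notMem
  haveI := h.isIntegral_pullback Kbar (ι ≫ s) hsD
  haveI := h.nontrivial_pullback Kbar (ι ≫ s) hsD
  -- `𝒞_η = pullback f s` is a single point: its points lie over `η`, injectively
  haveI : Subsingleton ↥(pullback f s) := by
    refine ⟨fun z z' => (pullback.fst f s).isEmbedding.injective ?_⟩
    have hz : ∀ w : ↥(pullback f s), pullback.fst f s w = genericPoint X := fun w =>
      hno _ (by rw [← Scheme.Hom.comp_apply, pullback.condition, Scheme.Hom.comp_apply, hs])
    rw [hz, hz]
  -- the integral morphism `𝒞 ×_Y Spec K̄ → 𝒞_η`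
  haveI : IsIntegralHom ι := by
    rw [IsIntegralHom.SpecMap_iff]
    show (algebraMap K Kbar).IsIntegral
    exact Algebra.IsIntegral.isIntegral
  let q : pullback f (ι ≫ s) ⟶ pullback f s :=
    (pullbackLeftPullbackSndIso f s ι).inv ≫ pullback.fst (pullback.snd f s) ι
  haveI : IsIntegralHom q := inferInstance
  -- two distinct comparable points of the integral scheme `𝒞 ×_Y Spec K̄` with the same image
  obtain ⟨x, hx⟩ := exists_ne (genericPoint (pullback f (ι ≫ s) : Scheme.{u}))
  exact hx (eq_of_specializes_of_isIntegralHom q (genericPoint_specializes x)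
    (Subsingleton.elim _ _)).symm

/-! ## `dim Y < dim 𝒞` -/

/-- **de Jong 1996, 4.22: the base of the family has dimension `dim 𝒞 - 1` — the inequality
`dim Y + 1 ≤ dim 𝒞`**: `f` is proper, hence closed and specializing, and its generic fibre has a
point other than the generic point of `𝒞` (`exists_ne_genericPoint`), so chains of `Y` lift and
extend (`topologicalKrullDim_base_add_one_le`). [cite: DeJong1996, 4.22, p. 74] -/
theorem topologicalKrullDim_add_one_le (h : PreSemiStablePair f g D τ) :
    topologicalKrullDim Y + 1 ≤ topologicalKrullDim X := by
  haveI := h.isIntegral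
  haveI := h.isIntegral_base
  haveI := h.isSemiStableCurve.isProper
  obtain ⟨b, hb, hne⟩ := h.exists_ne_genericPoint
  exact topologicalKrullDim_base_add_one_le f hb hne

/-- **`dim Y < dim 𝒞`** for a pre-semi-stable pair: `dim Y + 1 ≤ dim 𝒞` and `dim 𝒞 < ∞` (`𝒞` is
of finite type over `k`). [cite: DeJong1996, 4.22, p. 74] -/
theorem topologicalKrullDim_lt (h : PreSemiStablePair f g D τ) :
    topologicalKrullDim Y < topologicalKrullDim X := by
  haveI := h.isIntegral
  haveI := h.locallyOfFiniteType
  haveI : CompactSpace X :=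
    (HasAffineProperty.iff_of_isAffine (P := @QuasiCompact)).mp h.quasiCompact
  obtain ⟨d, hd⟩ := exists_topologicalKrullDim_le_of_locallyOfFiniteType (f ≫ g)
  have h1 := h.topologicalKrullDim_add_one_le
  -- `dim 𝒞` is neither `⊥` (`𝒞` is non-empty) nor `⊤` (`𝒞` is of finite type over `k`)
  have hb : topologicalKrullDim X ≠ ⊤ := fun htop => by
    rw [htop, ← WithBot.coe_top, ← WithBot.coe_natCast, WithBot.coe_le_coe] at hd
    exact absurd hd (not_le_of_gt (ENat.coe_lt_top d))
  have hb0 : topologicalKrullDim X ≠ ⊥ := by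
    unfold topologicalKrullDim
    rw [ne_eq, Order.krullDim_eq_bot_iff, not_isEmpty_iff]
    exact ⟨⟨Set.univ, IrreducibleSpace.isIrreducible_univ X, isClosed_univ⟩⟩
  exact WithBot.ENat.lt_of_add_one_le h1 hb0 hb

end PreSemiStablePair

end DeJong1996

/-! ## The assembly

`DeJong1996PreSemiStablePairToSemiStablePair.of_liu` — 4.22 from "At this point", from Liu 2002,
Prop. 4.3.8 alone — is already in the tree (`SemiStableFibreDimension.lean`, which bounds `dim Y`
through the closed fibres over an algebraically closed field). With
`PreSemiStablePair.topologicalKrullDim_lt` above, the term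
`DeJong1996PreSemiStablePairToSemiStablePair.of_liu_of_dim hL fun hP => hP.topologicalKrullDim_lt`
is the same reduction, without hypothesis on `k` in the dimension count. -/

end Literature.AlgebraicGeometry.Resolution

end
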